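import Mathlib
import Literature.Barriers.ValiantsHypothesis.AlgebraicNaturalProofs
import Summits.ValiantsHypothesis.ValiantsHypothesis.Theorems.BarrierLeverSuccinctHittingSetsForVPStubCatalecticantMaximal
import HarnessLib

/-!
# Crux `BarrierLever.SuccinctHittingSetsForVP` (stmt-ValiantsHypothesis-14610), line `registered` —
stub `stub_catalecticantDeterminant`: SYLVESTER'S SQUARE CATALECTICANT BLOCK IS NONSINGULAR ON A
SMALL CIRCUIT (the catalecticant DETERMINANT is hit by `SmallCircuits ℂ n 8`)

**What is proved (unconditional; evidence for the open item in the direction the crux predicts for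
rank methods; it does NOT close the item).**

* `stub_catalecticantDeterminant` : for `n ≥ 8` some `f ∈ SmallCircuits ℂ n 8` — the FACTORIAL
  polynomial `f = Σ_{|m| ≤ n} (∏_i m_i!) x^m` of `CatalecticantMaximal.exists_factorial_mem_smallCircuits`
  — has, for every `k ≤ n/2`, a NONSINGULAR square catalecticant block
  `R[u, w] = coeff_{u+w} f` (`|u| = |w| = k`): Sylvester's catalecticant determinant, a level-`O(1)`
  distinguisher, does not vanish on `SmallCircuits ℂ n 8`.

**Proof.** With that witness `R[u, w] = ∏_i (u_i + w_i)!` (`|u + w| = 2k ≤ n`), a matrix of natural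
numbers, so it suffices to work over `ℚ` (`Rat.cast_det`). The univariate Hankel moment matrix
`H[a, b] = (a + b)!` of the Laguerre weight has the Cholesky factorisation `H = (D B)(D B)ᵀ`,
`D = diag(a!)`, `B[a, j] = C(a, j)` (Pascal), i.e. `(a + b)! = Σ_j (a! C(a, j)) (b! C(b, j))`
(Vandermonde, `CatalecticantDeterminant.sum_range_factorial_mul_choose_nat`). Taking the product over
the coordinates (`Fintype.prod_sum`), `R = G Gᵀ` with `G[u, j] = ∏_i u_i! C(u_i, j_i)`, columns
`j : Fin n → Fin (k + 1)` (`CatalecticantDeterminant.of_prod_factorial_eq_mul_transpose`). The rows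
of `G` are independent: at the column `j = u₀` the entry `G[u, u₀] = ∏_i u_i! C(u_i, u₀_i)` vanishes
unless `u₀ ≤ u`, which for `|u| = |u₀|` forces `u = u₀` (`RisingDiagonal.eq_of_forall_le_of_degree_eq`),
where it is `∏_i u_i! ≠ 0`. Hence `det R = 0` is impossible: a kernel vector `v ≠ 0`
(`Matrix.exists_mulVec_eq_zero_iff`) would give `‖v ᵥ* G‖² = vᵀ G Gᵀ v = 0`, so `v ᵥ* G = 0`, so
`v = 0`. Axioms: `propext`, `Classical.choice`, `Quot.sound`.

References: Sylvester 1851/52 (catalecticants); Stieltjes moment matrices / [ForbesShpilkaVolk2018]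
§1.2 (rank methods are algebraically natural), Question 6.
-/

-- layout Summits/ValiantsHypothesis/ValiantsHypothesis forces the duplicated namespace component
set_option linter.dupNamespace false

namespace Summit.ValiantsHypothesis.ValiantsHypothesis.Theorems.BarrierLever.SuccinctHittingSetsForVP

open Literature.Barriers.ValiantsHypothesis Literature.Computability.AlgebraicComplexity MvPolynomial

namespace CatalecticantDeterminant

/-- Vandermonde's identity in "row" form: `Σ_{t ≤ a} C(a, t) C(b, t) = C(a + b, a)`. [folklore] -/
theorem sum_range_choose_mul_choose (a b : ℕ) :
    ∑ t ∈ Finset.range (a + 1), a.choose t * b.choose t = (a + b).choose a := by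
  rw [add_comm a b, Nat.add_choose_eq, Finset.Nat.sum_antidiagonal_eq_sum_range_succ_mk]
  refine Finset.sum_congr rfl fun t ht => ?_
  show a.choose t * b.choose t = b.choose t * a.choose (a - t)
  rw [Nat.choose_symm (Finset.mem_range_succ_iff.mp ht), mul_comm]

/-- The Cholesky factorisation of the Hankel matrix `[(a + b)!]` (Laguerre moments):
`Σ_{t ≤ a} (a! C(a, t)) (b! C(b, t)) = (a + b)!`. [folklore] -/
theorem sum_range_factorial_mul_choose_nat (a b : ℕ) :
    ∑ t ∈ Finset.range (a + 1), a.factorial * a.choose t * (b.factorial * b.choose t) =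
      (a + b).factorial := by
  calc ∑ t ∈ Finset.range (a + 1), a.factorial * a.choose t * (b.factorial * b.choose t)
      = a.factorial * b.factorial * ∑ t ∈ Finset.range (a + 1), a.choose t * b.choose t := by
        rw [Finset.mul_sum]
        exact Finset.sum_congr rfl fun t _ => by ring
    _ = (a + b).factorial := by
        rw [sum_range_choose_mul_choose, Nat.choose_symm_add,
          ← Nat.add_choose_mul_factorial_mul_factorial a b]
        ring

/-- The same factorisation with the sum extended by zero terms and cast to `ℚ`:
`Σ_{t ≤ N} (a! C(a, t)) (b! C(b, t)) = (a + b)!` for `a ≤ N`. [folklore] -/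
theorem sum_range_factorial_mul_choose (a b N : ℕ) (h : a ≤ N) :
    ∑ t ∈ Finset.range (N + 1),
        ((a.factorial * a.choose t : ℕ) : ℚ) * ((b.factorial * b.choose t : ℕ) : ℚ) =
      ((a + b).factorial : ℚ) := by
  have hsub : Finset.range (a + 1) ⊆ Finset.range (N + 1) :=
    Finset.range_subset_range.mpr (by omega)
  have hzero : ∀ t ∈ Finset.range (N + 1), t ∉ Finset.range (a + 1) →
      ((a.factorial * a.choose t : ℕ) : ℚ) * ((b.factorial * b.choose t : ℕ) : ℚ) = 0 := by
    intro t _ hta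
    rw [Finset.mem_range, not_lt] at hta
    rw [Nat.choose_eq_zero_of_lt (by omega), mul_zero, Nat.cast_zero, zero_mul]
  rw [← Finset.sum_subset hsub hzero, ← sum_range_factorial_mul_choose_nat a b, Nat.cast_sum]
  exact Finset.sum_congr rfl fun t _ => by push_cast; ring

/-- The factorisation summed over the column type `Fin (k + 1)`:
`Σ_{t : Fin (k+1)} (a! C(a, t)) (b! C(b, t)) = (a + b)!` for `a ≤ k`. [folklore] -/
theorem sum_fin_factorial_mul_choose (a b k : ℕ) (h : a ≤ k) :
    ∑ t : Fin (k + 1),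
        ((a.factorial * a.choose (t : ℕ) : ℕ) : ℚ) * ((b.factorial * b.choose (t : ℕ) : ℕ) : ℚ) =
      ((a + b).factorial : ℚ) :=
  (Fin.sum_univ_eq_sum_range _ _).trans (sum_range_factorial_mul_choose a b k h)

/-- **The multivariate Gram identity** `Σ_j G[u, j] G[w, j] = ∏_i (u_i + w_i)!` for
`G[u, j] = ∏_i u_i! C(u_i, j_i)`, columns `j : Fin n → Fin (k + 1)`, whenever `u ≤ k` pointwise:
the product over the coordinates of the univariate Cholesky factorisations. [folklore] -/
theorem sum_prod_factorial_mul_choose {n k : ℕ} (u w : Fin n →₀ ℕ) (hu : ∀ i, u i ≤ k) :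
    ∑ j : Fin n → Fin (k + 1),
        (∏ i, (((u i).factorial * (u i).choose (j i : ℕ) : ℕ) : ℚ)) *
          ∏ i, (((w i).factorial * (w i).choose (j i : ℕ) : ℕ) : ℚ) =
      ∏ i, (((u + w) i).factorial : ℚ) := by
  calc ∑ j : Fin n → Fin (k + 1),
        (∏ i, (((u i).factorial * (u i).choose (j i : ℕ) : ℕ) : ℚ)) *
          ∏ i, (((w i).factorial * (w i).choose (j i : ℕ) : ℕ) : ℚ)
      = ∑ j : Fin n → Fin (k + 1), ∏ i, ((((u i).factorial * (u i).choose (j i : ℕ) : ℕ) : ℚ) *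
          (((w i).factorial * (w i).choose (j i : ℕ) : ℕ) : ℚ)) :=
        Finset.sum_congr rfl fun j _ => Finset.prod_mul_distrib.symm
    _ = ∏ i, ∑ t : Fin (k + 1), ((((u i).factorial * (u i).choose (t : ℕ) : ℕ) : ℚ) *
          (((w i).factorial * (w i).choose (t : ℕ) : ℕ) : ℚ)) :=
        (Fintype.prod_sum (fun i (t : Fin (k + 1)) =>
          (((u i).factorial * (u i).choose (t : ℕ) : ℕ) : ℚ) *
            (((w i).factorial * (w i).choose (t : ℕ) : ℕ) : ℚ))).symm
    _ = ∏ i, (((u + w) i).factorial : ℚ) := Finset.prod_congr rfl fun i _ => by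
        rw [sum_fin_factorial_mul_choose (u i) (w i) k (hu i), Finsupp.add_apply, Nat.cast_inj]

/-- **`R = G Gᵀ`**: the square catalecticant block `R[u, w] = ∏_i (u_i + w_i)!` on the slice
`|u| = |w| = k` is the Gram matrix of the rows of `G[u, j] = ∏_i u_i! C(u_i, j_i)`
(`j : Fin n → Fin (k + 1)`). [folklore] -/
theorem of_prod_factorial_eq_mul_transpose {n k : ℕ} [Fintype {u : Fin n →₀ ℕ // u.degree = k}] :
    (Matrix.of fun u w : {u : Fin n →₀ ℕ // u.degree = k} =>
        ∏ i, (((u.1 + w.1) i).factorial : ℚ)) =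
      (Matrix.of fun (u : {u : Fin n →₀ ℕ // u.degree = k}) (j : Fin n → Fin (k + 1)) =>
          ∏ i, (((u.1 i).factorial * (u.1 i).choose (j i : ℕ) : ℕ) : ℚ)) *
        (Matrix.of fun (u : {u : Fin n →₀ ℕ // u.degree = k}) (j : Fin n → Fin (k + 1)) =>
          ∏ i, (((u.1 i).factorial * (u.1 i).choose (j i : ℕ) : ℕ) : ℚ)).transpose := by
  ext u w
  rw [Matrix.mul_apply]
  simp only [Matrix.of_apply, Matrix.transpose_apply]
  exact (sum_prod_factorial_mul_choose u.1 w.1 fun i => (Finsupp.le_degree i u.1).trans u.2.le).symm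

/-- Off the diagonal of the slice `|u| = |u₀|` the entry `G[u, u₀] = ∏_i u_i! C(u_i, u₀_i)` vanishes:
`u₀ ≤ u` with equal degrees would force `u = u₀`. [folklore] -/
theorem prod_factorial_mul_choose_eq_zero {n : ℕ} {u u₀ : Fin n →₀ ℕ} (hdeg : u.degree = u₀.degree)
    (hne : u ≠ u₀) : ∏ i, (((u i).factorial * (u i).choose (u₀ i) : ℕ) : ℚ) = 0 := by
  have h : ¬ ∀ i, u₀ i ≤ u i := fun hle => hne (RisingDiagonal.eq_of_forall_le_of_degree_eq hle hdeg)
  push Not at h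
  obtain ⟨i, hi⟩ := h
  exact Finset.prod_eq_zero (Finset.mem_univ i)
    (by rw [Nat.choose_eq_zero_of_lt hi, mul_zero, Nat.cast_zero])

/-- On the diagonal the entry `G[u, u] = ∏_i u_i!` is nonzero. [folklore] -/
theorem prod_factorial_mul_choose_self_ne_zero {n : ℕ} (u : Fin n →₀ ℕ) :
    ∏ i, (((u i).factorial * (u i).choose (u i) : ℕ) : ℚ) ≠ 0 := by
  refine Finset.prod_ne_zero_iff.mpr fun i _ => ?_
  rw [Nat.choose_self, mul_one, Nat.cast_ne_zero]
  exact Nat.factorial_ne_zero _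

/-- **The rows of `G` are independent**: `v ᵥ* G = 0 → v = 0` (evaluate at the diagonal column
`j = u₀`, where the column of `G` is supported on the single row `u₀`). [folklore] -/
theorem eq_zero_of_vecMul_eq_zero {n k : ℕ} [Fintype {u : Fin n →₀ ℕ // u.degree = k}]
    (v : {u : Fin n →₀ ℕ // u.degree = k} → ℚ)
    (hv : Matrix.vecMul v
        (Matrix.of fun (u : {u : Fin n →₀ ℕ // u.degree = k}) (j : Fin n → Fin (k + 1)) =>
          ∏ i, (((u.1 i).factorial * (u.1 i).choose (j i : ℕ) : ℕ) : ℚ)) = 0) :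
    v = 0 := by
  funext u₀
  have hlt : ∀ i, u₀.1 i < k + 1 := fun i =>
    Nat.lt_succ_of_le ((Finsupp.le_degree i u₀.1).trans u₀.2.le)
  have h := congrFun hv (fun i => ⟨u₀.1 i, hlt i⟩)
  simp only [Matrix.vecMul, dotProduct, Matrix.of_apply, Pi.zero_apply] at h
  rw [Finset.sum_eq_single u₀] at h
  · exact (mul_eq_zero.mp h).resolve_right (prod_factorial_mul_choose_self_ne_zero u₀.1)
  · intro u _ hne
    rw [prod_factorial_mul_choose_eq_zero (u.2.trans u₀.2.symm) fun h => hne (Subtype.ext h),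
      mul_zero]
  · intro h'
    exact absurd (Finset.mem_univ u₀) h'

/-- **Sylvester's square catalecticant block of the factorial polynomial is nonsingular** (over `ℚ`):
`det [∏_i (u_i + w_i)!]_{|u| = |w| = k} ≠ 0` — a kernel vector `v` of `R = G Gᵀ` has
`‖v ᵥ* G‖² = vᵀ R v = 0`, hence `v ᵥ* G = 0`, hence `v = 0`. [folklore] -/
theorem det_of_prod_factorial_ne_zero {n k : ℕ} [Fintype {u : Fin n →₀ ℕ // u.degree = k}] :
    (Matrix.of fun u w : {u : Fin n →₀ ℕ // u.degree = k} =>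
        ∏ i, (((u.1 + w.1) i).factorial : ℚ)).det ≠ 0 := by
  intro hdet
  obtain ⟨v, hv0, hv⟩ := Matrix.exists_mulVec_eq_zero_iff.mpr hdet
  rw [of_prod_factorial_eq_mul_transpose, ← Matrix.mulVec_mulVec, Matrix.mulVec_transpose] at hv
  have h := congrArg (dotProduct v) hv
  rw [dotProduct_zero, Matrix.dotProduct_mulVec, dotProduct_self_eq_zero] at h
  exact hv0 (eq_zero_of_vecMul_eq_zero v h)

end CatalecticantDeterminant

open CatalecticantMaximal CatalecticantDeterminant in
/-- **Registered stub `stub_catalecticantDeterminant`** (crux stmt-ValiantsHypothesis-14610, line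
`registered`; wave 7): for `n ≥ 8` some `f ∈ SmallCircuits ℂ n 8` (the factorial polynomial) has,
for every `k ≤ n/2`, a NONSINGULAR square catalecticant block `[coeff_{u+w} f]_{|u| = |w| = k}`:
Sylvester's catalecticant determinant is hit by a small circuit (the block is the positive-definite
Laguerre moment matrix `[∏_i (u_i + w_i)!]`). [folklore] -/
theorem stub_catalecticantDeterminant :
    ∀ n : ℕ, 8 ≤ n → ∃ f ∈ SmallCircuits ℂ n 8, ∀ (k : ℕ) [Fintype {u : Fin n →₀ ℕ // u.degree = k}],
      2 * k ≤ n →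
        (Matrix.of fun u w : {u : Fin n →₀ ℕ // u.degree = k} =>
          MvPolynomial.coeff (u.1 + w.1) f).det ≠ 0 := by
  intro n hn
  obtain ⟨f, hf, hcoef⟩ := exists_factorial_mem_smallCircuits n hn
  refine ⟨f, hf, ?_⟩
  intro k _ hk
  have hM : (Matrix.of fun u w : {u : Fin n →₀ ℕ // u.degree = k} =>
        MvPolynomial.coeff (u.1 + w.1) f) =
      (Matrix.of fun u w : {u : Fin n →₀ ℕ // u.degree = k} =>
        ∏ i, (((u.1 + w.1) i).factorial : ℚ)).map (fun x : ℚ => (x : ℂ)) := by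
    ext u w
    have hdeg : (u.1 + w.1).degree ≤ n := by
      rw [map_add, u.2, w.2]
      omega
    simp only [Matrix.map_apply, Matrix.of_apply, Rat.cast_prod, Rat.cast_natCast]
    exact hcoef _ hdeg
  rw [hM, ← Rat.cast_det, Rat.cast_ne_zero]
  exact det_of_prod_factorial_ne_zero

end Summit.ValiantsHypothesis.ValiantsHypothesis.Theorems.BarrierLever.SuccinctHittingSetsForVP
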